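import Literature.MathematicalPhysics.QuantumLattice.HubbardTorusFluxBlochBound

/-!
# Flux response of the Hubbard torus: what a flux stiffness forces on sector ground states

Topic `Literature/MathematicalPhysics/QuantumLattice` (family `hubbard`); companion of
`HubbardTorusFlux.lean` (`fluxEnergy`, `fluxEnergy_neg`) and `HubbardTorusFluxBlochBound.lean`
(`fluxEnergy_le_rayleigh_uniformTwist`, `fluxEnergy_le_fluxEnergy_zero_add_two_mul_sq`).
Everything here is PROVED; no definitions, no named facts.

Setting: the flux envelope `E_L(θ) = fluxEnergy L U δ θ` (lowest energy of the seam-twisted torus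
`hubbardTorusFlux L U θ` in the `(N_L, S^z = 0)` sector, `N_L = 2⌊(1-δ)L²/2⌋`) and a zero-flux
sector ground state `ψ` (`IsGroundStateInSector (hubbardTorus 2 L 1 U) N_L 0 ψ`, `‖ψ‖ = 1`), with its
`e₁`-kinetic weight `K(ψ) = Σ_{x,σ} Re⟨ψ, c†_{x+e₁,σ} c_{x,σ} ψ⟩` and total `e₁`-current
`J(ψ) = Σ_{x,σ} Im⟨ψ, c†_{x+e₁,σ} c_{x,σ} ψ⟩`. A (uniform) flux stiffness is a bound
`ρ_s θ² ≤ E_L(θ) - E_L(0)` for `|θ| ≤ θ₀` — the helicity modulus / superfluid weight floor of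
Scalapino–White–Zhang (1993), the negation of Kohn's (1964) insulator criterion. Pricing `ψ` in the
uniformly twisted torus (Watanabe 2019 §2.2.1: `E_L(θ) ≤ E_L(0) + 2(1 - cos(θ/L)) K(ψ) + 2 sin(θ/L) J(ψ)`)
at `±θ` and using evenness `E_L(-θ) = E_L(θ)` (Byers–Yang 1961) gives:

* `stiffness_le_two` — Bloch ceiling: a stiffness constant is at most `2`.
* `fluxEnergy_sub_le_of_isGroundStateInSector`, `fluxEnergy_sub_le_kinetic_of_isGroundStateInSector`
  — the pricing at a ground state and its `±θ` average `E_L(θ) - E_L(0) ≤ 2(1 - cos(θ/L)) K(ψ)`.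
* `two_mul_abs_sin_mul_sum_im_hop_le` — the current term is controlled by the kinetic slack:
  `2|sin(θ/L) J(ψ)| ≤ 2(1 - cos(θ/L)) K(ψ) - (E_L(θ) - E_L(0))`.
* `sum_im_hop_eq_zero_of_isGroundStateInSector` — if `θ = 0` is a local minimum of the flux envelope
  (weaker than stiffness), then EVERY zero-flux `(N_L,0)`-sector ground state carries zero total
  `e₁`-current, `J(ψ) = 0` — including every complex superposition inside a degenerate sector ground
  space (the first-order flux response, i.e. the persistent current, must vanish on the whole ground
  space; Bloch's theorem, Bohm 1949 / Watanabe 2019, alone only bounds `|J|` by `O(L)`).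
* `stiffness_mul_sq_le_sum_re_hop_of_isGroundStateInSector` — f-sum-type floor: stiffness `ρ_s > 0`
  up to `θ₀` forces `ρ_s L² ≤ K(ψ)` (extensive `e₁`-kinetic energy of density at least `ρ_s`;
  Scalapino–White–Zhang 1993, `D_s/πe² ≤ ⟨-k_x⟩`).
* `fluxStiffness_consequences` — the same packaged against a stiffness hypothesis uniform in large
  even `L` (the form used by route `HubbardSuperconductivity/ParityGapRigidity`, crux
  `IncommensurateRigidity`, whose flux-side cut concludes exactly this hypothesis): necessary
  conditions any derivation of such a stiffness must deliver.

## References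

* D. Bohm, Phys. Rev. 75 (1949) 502 (Bloch's theorem on persistent currents). [Bohm1949]
* H. Watanabe, J. Stat. Phys. 177 (2019) 717, §2.2.1 eqs. (13)–(16), §4.1. [Watanabe2019]
* D. J. Scalapino, S. R. White, S. C. Zhang, PRB 47 (1993) 7995 (superfluid weight, `D_s ≤ ⟨-k_x⟩`).
  [ScalapinoWhiteZhang1993]
* N. Byers, C. N. Yang, PRL 7 (1961) 46 (`E(-Φ) = E(Φ)`). [ByersYang1961]
* W. Kohn, Phys. Rev. 133 (1964) A171 (insulator ⟺ no flux stiffness). [Kohn1964]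
-/

noncomputable section

namespace Literature.MathematicalPhysics.QuantumLattice

open Matrix Finset Real Literature.MathematicalPhysics.QuantumFieldTheory

variable {L : ℕ} [NeZero L]

/-- **Bloch ceiling on the stiffness constant.** If `ρ_s θ² ≤ E_L(θ) - E_L(0)` at one nonzero flux
`θ`, then `ρ_s ≤ 2`: the tree's Bloch bound `E_L(θ) ≤ E_L(0) + 2θ²`
(`fluxEnergy_le_fluxEnergy_zero_add_two_mul_sq`, Bohm 1949 / Watanabe 2019 §4.1). [folklore] -/
theorem stiffness_le_two (U δ : ℝ) {ρs θ : ℝ} (hθ : θ ≠ 0)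
    (h : ρs * θ ^ 2 ≤ fluxEnergy L U δ θ - fluxEnergy L U δ 0) : ρs ≤ 2 := by
  have hB := fluxEnergy_le_fluxEnergy_zero_add_two_mul_sq (L := L) U δ θ
  have hθ2 : 0 < θ ^ 2 := by positivity
  nlinarith

/-- A zero-flux `(N_L, 0)`-sector ground state realises the zero-flux envelope value:
`Re⟨ψ, H ψ⟩ = E_L(0)` (`H ψ = E₀ ψ` with `E₀` the sector energy, `‖ψ‖ = 1`, and
`hubbardTorusFlux L U 0 = hubbardTorus 2 L 1 U`). [folklore] -/
theorem re_star_dotProduct_mulVec_eq_fluxEnergy_zero (U δ : ℝ) {ψ : Fock (Orb (FermionTorus 2 L))}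
    (hgs : IsGroundStateInSector (hubbardTorus 2 L 1 U) (2 * ⌊(1 - δ) * (L : ℝ) ^ 2 / 2⌋₊) 0 ψ)
    (h1 : star ψ ⬝ᵥ ψ = 1) :
    (star ψ ⬝ᵥ (hubbardTorus 2 L 1 U *ᵥ ψ)).re = fluxEnergy L U δ 0 := by
  obtain ⟨-, -, hH⟩ := hgs
  rw [hH, dotProduct_smul, h1, smul_eq_mul, mul_one, Complex.ofReal_re, fluxEnergy_eq,
    hubbardTorusFlux_zero]

/-- **Pricing a sector ground state in the twisted torus** (`L ≥ 3`): for every zero-flux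
`(N_L, 0)`-sector ground state `ψ`,
`E_L(θ) - E_L(0) ≤ 2(1 - cos(θ/L)) K(ψ) + 2 sin(θ/L) J(ψ)`, with `K`, `J` the `e₁`-kinetic weight
and `e₁`-current of `ψ` (Watanabe 2019 §2.2.1 eqs. (13)–(16), applied to a ground state). [folklore] -/
theorem fluxEnergy_sub_le_of_isGroundStateInSector (hL : 3 ≤ L) (U δ θ : ℝ)
    {ψ : Fock (Orb (FermionTorus 2 L))}
    (hgs : IsGroundStateInSector (hubbardTorus 2 L 1 U) (2 * ⌊(1 - δ) * (L : ℝ) ^ 2 / 2⌋₊) 0 ψ)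
    (h1 : star ψ ⬝ᵥ ψ = 1) :
    fluxEnergy L U δ θ - fluxEnergy L U δ 0 ≤
      2 * (1 - Real.cos (θ / L)) *
        (∑ x : Site 2 L, ∑ σ : Fin 2,
          (star ψ ⬝ᵥ ((creation (orb (FermionTorus.ofTorusSite (Site.shift x 0)) σ) *
            annihilation (orb (FermionTorus.ofTorusSite x) σ)) *ᵥ ψ)).re) +
      2 * Real.sin (θ / L) *
        (∑ x : Site 2 L, ∑ σ : Fin 2,
          (star ψ ⬝ᵥ ((creation (orb (FermionTorus.ofTorusSite (Site.shift x 0)) σ) *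
            annihilation (orb (FermionTorus.ofTorusSite x) σ)) *ᵥ ψ)).im) := by
  have h := fluxEnergy_le_rayleigh_uniformTwist hL U δ θ ψ hgs.1 h1
  rw [re_star_dotProduct_mulVec_eq_fluxEnergy_zero U δ hgs h1] at h
  linarith

/-- **The `±θ` average**: for a zero-flux sector ground state `ψ` and every flux `θ`,
`E_L(θ) - E_L(0) ≤ 2(1 - cos(θ/L)) K(ψ)` — price `ψ` at `θ` and at `-θ` and use
`E_L(-θ) = E_L(θ)` (`fluxEnergy_neg`, Byers–Yang 1961); the current term cancels. [folklore] -/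
theorem fluxEnergy_sub_le_kinetic_of_isGroundStateInSector (hL : 3 ≤ L) (U δ θ : ℝ)
    {ψ : Fock (Orb (FermionTorus 2 L))}
    (hgs : IsGroundStateInSector (hubbardTorus 2 L 1 U) (2 * ⌊(1 - δ) * (L : ℝ) ^ 2 / 2⌋₊) 0 ψ)
    (h1 : star ψ ⬝ᵥ ψ = 1) :
    fluxEnergy L U δ θ - fluxEnergy L U δ 0 ≤
      2 * (1 - Real.cos (θ / L)) *
        (∑ x : Site 2 L, ∑ σ : Fin 2,
          (star ψ ⬝ᵥ ((creation (orb (FermionTorus.ofTorusSite (Site.shift x 0)) σ) *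
            annihilation (orb (FermionTorus.ofTorusSite x) σ)) *ᵥ ψ)).re) := by
  have hp := fluxEnergy_sub_le_of_isGroundStateInSector hL U δ θ hgs h1
  have hm := fluxEnergy_sub_le_of_isGroundStateInSector hL U δ (-θ) hgs h1
  rw [neg_div, Real.cos_neg, Real.sin_neg, fluxEnergy_neg] at hm
  linarith

/-- **The current term is controlled by the kinetic slack**: for a zero-flux sector ground state `ψ`
and every flux `θ`, `2|sin(θ/L) J(ψ)| ≤ 2(1 - cos(θ/L)) K(ψ) - (E_L(θ) - E_L(0))` (the two
pricings at `±θ`, `E_L` even). [folklore] -/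
theorem two_mul_abs_sin_mul_sum_im_hop_le (hL : 3 ≤ L) (U δ θ : ℝ)
    {ψ : Fock (Orb (FermionTorus 2 L))}
    (hgs : IsGroundStateInSector (hubbardTorus 2 L 1 U) (2 * ⌊(1 - δ) * (L : ℝ) ^ 2 / 2⌋₊) 0 ψ)
    (h1 : star ψ ⬝ᵥ ψ = 1) :
    2 * |Real.sin (θ / L) *
        ∑ x : Site 2 L, ∑ σ : Fin 2,
          (star ψ ⬝ᵥ ((creation (orb (FermionTorus.ofTorusSite (Site.shift x 0)) σ) *
            annihilation (orb (FermionTorus.ofTorusSite x) σ)) *ᵥ ψ)).im| ≤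
      2 * (1 - Real.cos (θ / L)) *
        (∑ x : Site 2 L, ∑ σ : Fin 2,
          (star ψ ⬝ᵥ ((creation (orb (FermionTorus.ofTorusSite (Site.shift x 0)) σ) *
            annihilation (orb (FermionTorus.ofTorusSite x) σ)) *ᵥ ψ)).re) -
        (fluxEnergy L U δ θ - fluxEnergy L U δ 0) := by
  have hp := fluxEnergy_sub_le_of_isGroundStateInSector hL U δ θ hgs h1
  have hm := fluxEnergy_sub_le_of_isGroundStateInSector hL U δ (-θ) hgs h1
  rw [neg_div, Real.cos_neg, Real.sin_neg, fluxEnergy_neg] at hm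
  set K : ℝ := ∑ x : Site 2 L, ∑ σ : Fin 2,
    (star ψ ⬝ᵥ ((creation (orb (FermionTorus.ofTorusSite (Site.shift x 0)) σ) *
      annihilation (orb (FermionTorus.ofTorusSite x) σ)) *ᵥ ψ)).re with hK
  set J : ℝ := ∑ x : Site 2 L, ∑ σ : Fin 2,
    (star ψ ⬝ᵥ ((creation (orb (FermionTorus.ofTorusSite (Site.shift x 0)) σ) *
      annihilation (orb (FermionTorus.ofTorusSite x) σ)) *ᵥ ψ)).im with hJ
  have h : |Real.sin (θ / L) * J| ≤
      (2 * (1 - Real.cos (θ / L)) * K - (fluxEnergy L U δ θ - fluxEnergy L U δ 0)) / 2 :=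
    abs_le.2 ⟨by linarith, by linarith⟩
  linarith

/-- **Zero first-order flux response ⟹ zero ground-state current.** If `θ = 0` is a local minimum of
the flux envelope, `E_L(0) ≤ E_L(θ)` for `|θ| ≤ θ₀` (in particular under uniform flux stiffness),
then every zero-flux `(N_L, 0)`-sector ground state `ψ` of `hubbardTorus 2 L 1 U` (`L ≥ 3`) has zero
total `e₁`-current: `Σ_{x,σ} Im⟨ψ, c†_{x+e₁,σ} c_{x,σ} ψ⟩ = 0`. This applies to EVERY vector of a
degenerate sector ground space, so a current-carrying ground space makes the envelope dip strictly
below `E_L(0)` near `θ = 0` (persistent current `= ∂_θ E`; Bloch/Bohm 1949 only bounds it by `O(L)`).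
Proof: `2 sin(θ/L)|J| ≤ 2(1 - cos(θ/L))K ≤ (θ/L)² · 2L²` and Jordan's inequality give
`|J| ≤ (π L/2) θ` for all small `θ > 0`. [folklore] -/
theorem sum_im_hop_eq_zero_of_isGroundStateInSector (hL : 3 ≤ L) (U δ : ℝ) {θ₀ : ℝ} (hθ₀ : 0 < θ₀)
    (hmin : ∀ θ : ℝ, |θ| ≤ θ₀ → fluxEnergy L U δ 0 ≤ fluxEnergy L U δ θ)
    {ψ : Fock (Orb (FermionTorus 2 L))}
    (hgs : IsGroundStateInSector (hubbardTorus 2 L 1 U) (2 * ⌊(1 - δ) * (L : ℝ) ^ 2 / 2⌋₊) 0 ψ)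
    (h1 : star ψ ⬝ᵥ ψ = 1) :
    ∑ x : Site 2 L, ∑ σ : Fin 2,
      (star ψ ⬝ᵥ ((creation (orb (FermionTorus.ofTorusSite (Site.shift x 0)) σ) *
        annihilation (orb (FermionTorus.ofTorusSite x) σ)) *ᵥ ψ)).im = 0 := by
  set K : ℝ := ∑ x : Site 2 L, ∑ σ : Fin 2,
    (star ψ ⬝ᵥ ((creation (orb (FermionTorus.ofTorusSite (Site.shift x 0)) σ) *
      annihilation (orb (FermionTorus.ofTorusSite x) σ)) *ᵥ ψ)).re with hK
  set J : ℝ := ∑ x : Site 2 L, ∑ σ : Fin 2,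
    (star ψ ⬝ᵥ ((creation (orb (FermionTorus.ofTorusSite (Site.shift x 0)) σ) *
      annihilation (orb (FermionTorus.ofTorusSite x) σ)) *ᵥ ψ)).im with hJ
  have hL0 : (0 : ℝ) < L := Nat.cast_pos.2 (NeZero.pos L)
  have hπ0 : 0 < Real.pi := Real.pi_pos
  have hKle : |K| ≤ 2 * (L : ℝ) ^ 2 := abs_sum_re_hop_le h1
  -- the linear bound `|J| ≤ (π L / 2) θ` for `0 < θ ≤ min θ₀ L`
  have hlin : ∀ θ : ℝ, 0 < θ → θ ≤ θ₀ → θ ≤ L → |J| ≤ Real.pi * L / 2 * θ := by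
    intro θ hθ hθ₀' hθL
    have hu0 : 0 ≤ θ / L := by positivity
    have hu1 : θ / L ≤ Real.pi / 2 := by
      rw [div_le_iff₀ hL0]
      nlinarith [Real.pi_gt_three]
    have hsin : 2 / Real.pi * (θ / L) ≤ Real.sin (θ / L) := Real.mul_le_sin hu0 hu1
    have hsin0 : 0 ≤ Real.sin (θ / L) := le_trans (by positivity) hsin
    have hpm := two_mul_abs_sin_mul_sum_im_hop_le hL U δ θ hgs h1
    rw [← hK, ← hJ, abs_mul, abs_of_nonneg hsin0] at hpm
    have hE : fluxEnergy L U δ 0 ≤ fluxEnergy L U δ θ :=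
      hmin θ (by rw [abs_of_pos hθ]; exact hθ₀')
    have hc : 0 ≤ 1 - Real.cos (θ / L) := sub_nonneg.2 (Real.cos_le_one _)
    -- `2(1 - cos(θ/L)) K ≤ (θ/L)² |K| ≤ 2 θ²`
    have hKstep : 2 * (1 - Real.cos (θ / L)) * K ≤ 2 * θ ^ 2 :=
      calc 2 * (1 - Real.cos (θ / L)) * K ≤ 2 * (1 - Real.cos (θ / L)) * |K| := by
            have := le_abs_self K; nlinarith
        _ ≤ (θ / L) ^ 2 * |K| := two_mul_one_sub_cos_mul_le _ _ (abs_nonneg K)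
        _ ≤ (θ / L) ^ 2 * (2 * (L : ℝ) ^ 2) := by gcongr
        _ = 2 * θ ^ 2 := by field_simp
    have hJsin : 2 * (Real.sin (θ / L) * |J|) ≤ 2 * θ ^ 2 := by linarith
    -- combine with Jordan: `(2/π)(θ/L) |J| ≤ θ²`
    have hJabs : 0 ≤ |J| := abs_nonneg J
    have h4 : 2 / Real.pi * (θ / L) * |J| ≤ θ ^ 2 := by
      have := mul_le_mul_of_nonneg_right hsin hJabs
      linarith
    have hcoef : 0 < 2 / Real.pi * (θ / L) := by positivity
    calc |J| = (2 / Real.pi * (θ / L))⁻¹ * (2 / Real.pi * (θ / L) * |J|) := by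
          field_simp
      _ ≤ (2 / Real.pi * (θ / L))⁻¹ * θ ^ 2 := by gcongr
      _ = Real.pi * L / 2 * θ := by field_simp
  -- let `θ → 0⁺`: if `J ≠ 0`, the flux `θ = min (min θ₀ L) (|J| / (π L))` gives `|J| ≤ |J| / 2`
  by_contra hne
  have hJpos : 0 < |J| := abs_pos.2 hne
  set θ : ℝ := min (min θ₀ L) (|J| / (Real.pi * L)) with hθ
  have hθpos : 0 < θ := lt_min (lt_min hθ₀ hL0) (by positivity)
  have hθ₀' : θ ≤ θ₀ := (min_le_left _ _).trans (min_le_left _ _)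
  have hθL : θ ≤ L := (min_le_left _ _).trans (min_le_right _ _)
  have hθJ : θ ≤ |J| / (Real.pi * L) := min_le_right _ _
  have h := hlin θ hθpos hθ₀' hθL
  have h' : Real.pi * L / 2 * θ ≤ Real.pi * L / 2 * (|J| / (Real.pi * L)) := by gcongr
  rw [show Real.pi * L / 2 * (|J| / (Real.pi * L)) = |J| / 2 by field_simp] at h'
  linarith

/-- **Stiffness forces extensive `e₁`-kinetic energy (f-sum floor).** If `ρ_s θ² ≤ E_L(θ) - E_L(0)`
for `|θ| ≤ θ₀` with `ρ_s, θ₀ > 0`, then every zero-flux `(N_L, 0)`-sector ground state `ψ` of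
`hubbardTorus 2 L 1 U` (`L ≥ 3`) has `ρ_s L² ≤ K(ψ) = Σ_{x,σ} Re⟨ψ, c†_{x+e₁,σ} c_{x,σ} ψ⟩`: the
superfluid weight is bounded by the `e₁`-kinetic energy density (Scalapino–White–Zhang 1993,
`D_s/πe² ≤ ⟨-k_x⟩`). Proof: the `±θ₀` average gives `ρ_s θ₀² ≤ 2(1 - cos(θ₀/L)) K`, which forces
`K ≥ 0` and then is `≤ (θ₀/L)² K`. [folklore] -/
theorem stiffness_mul_sq_le_sum_re_hop_of_isGroundStateInSector (hL : 3 ≤ L) (U δ : ℝ)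
    {ρs θ₀ : ℝ} (hρs : 0 < ρs) (hθ₀ : 0 < θ₀)
    (hstiff : ∀ θ : ℝ, |θ| ≤ θ₀ → ρs * θ ^ 2 ≤ fluxEnergy L U δ θ - fluxEnergy L U δ 0)
    {ψ : Fock (Orb (FermionTorus 2 L))}
    (hgs : IsGroundStateInSector (hubbardTorus 2 L 1 U) (2 * ⌊(1 - δ) * (L : ℝ) ^ 2 / 2⌋₊) 0 ψ)
    (h1 : star ψ ⬝ᵥ ψ = 1) :
    ρs * (L : ℝ) ^ 2 ≤ ∑ x : Site 2 L, ∑ σ : Fin 2,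
      (star ψ ⬝ᵥ ((creation (orb (FermionTorus.ofTorusSite (Site.shift x 0)) σ) *
        annihilation (orb (FermionTorus.ofTorusSite x) σ)) *ᵥ ψ)).re := by
  set K : ℝ := ∑ x : Site 2 L, ∑ σ : Fin 2,
    (star ψ ⬝ᵥ ((creation (orb (FermionTorus.ofTorusSite (Site.shift x 0)) σ) *
      annihilation (orb (FermionTorus.ofTorusSite x) σ)) *ᵥ ψ)).re with hK
  have hL0 : (0 : ℝ) < L := Nat.cast_pos.2 (NeZero.pos L)
  have hav := fluxEnergy_sub_le_kinetic_of_isGroundStateInSector hL U δ θ₀ hgs h1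
  rw [← hK] at hav
  have hE := hstiff θ₀ (by rw [abs_of_pos hθ₀])
  -- `ρ_s θ₀² ≤ 2(1 - cos(θ₀/L)) K`
  have h2 : ρs * θ₀ ^ 2 ≤ 2 * (1 - Real.cos (θ₀ / L)) * K := hE.trans hav
  have hc : 0 ≤ 1 - Real.cos (θ₀ / L) := sub_nonneg.2 (Real.cos_le_one _)
  have hθ2 : 0 < θ₀ ^ 2 := by positivity
  have hKpos : 0 ≤ K := by
    by_contra hneg
    have hneg' : K < 0 := lt_of_not_ge hneg
    have : 2 * (1 - Real.cos (θ₀ / L)) * K ≤ 0 :=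
      mul_nonpos_of_nonneg_of_nonpos (by positivity) hneg'.le
    nlinarith
  have hstep : 2 * (1 - Real.cos (θ₀ / L)) * K ≤ (θ₀ / L) ^ 2 * K :=
    two_mul_one_sub_cos_mul_le _ _ hKpos
  have h3 : ρs * θ₀ ^ 2 ≤ θ₀ ^ 2 / (L : ℝ) ^ 2 * K := by
    have := h2.trans hstep; rwa [div_pow] at this
  rw [div_mul_eq_mul_div, le_div_iff₀ (by positivity)] at h3
  nlinarith

/-- **What a flux stiffness uniform in large even `L` forces** (the hypothesis is, verbatim, the
`FluxStiffness U δ` of the flux-side cut of crux `IncommensurateRigidity`, route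
`HubbardSuperconductivity/ParityGapRigidity`): the stiffness constant is at most `2` (Bloch), and
for all large even `L` every zero-flux `(N_L, 0)`-sector ground state `ψ` of `hubbardTorus 2 L 1 U`
carries zero total `e₁`-current and has `e₁`-kinetic weight `K(ψ) ≥ ρ_s L²` — necessary conditions
any derivation of such a stiffness must deliver (Kohn 1964; Scalapino–White–Zhang 1993). [folklore] -/
theorem fluxStiffness_consequences (U δ : ℝ)
    (hFS : ∃ ρs θ₀ : ℝ, 0 < ρs ∧ 0 < θ₀ ∧ ∃ L₁ : ℕ, ∀ (L : ℕ) [NeZero L], L₁ ≤ L → Even L →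
      ∀ θ : ℝ, |θ| ≤ θ₀ → ρs * θ ^ 2 ≤ fluxEnergy L U δ θ - fluxEnergy L U δ 0) :
    ∃ ρs : ℝ, 0 < ρs ∧ ρs ≤ 2 ∧ ∃ L₁ : ℕ, ∀ (L : ℕ) [NeZero L], L₁ ≤ L → Even L →
      ∀ ψ : Fock (Orb (FermionTorus 2 L)),
        IsGroundStateInSector (hubbardTorus 2 L 1 U) (2 * ⌊(1 - δ) * (L : ℝ) ^ 2 / 2⌋₊) 0 ψ →
        star ψ ⬝ᵥ ψ = 1 →
          (∑ x : Site 2 L, ∑ σ : Fin 2,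
            (star ψ ⬝ᵥ ((creation (orb (FermionTorus.ofTorusSite (Site.shift x 0)) σ) *
              annihilation (orb (FermionTorus.ofTorusSite x) σ)) *ᵥ ψ)).im) = 0 ∧
          ρs * (L : ℝ) ^ 2 ≤ ∑ x : Site 2 L, ∑ σ : Fin 2,
            (star ψ ⬝ᵥ ((creation (orb (FermionTorus.ofTorusSite (Site.shift x 0)) σ) *
              annihilation (orb (FermionTorus.ofTorusSite x) σ)) *ᵥ ψ)).re := by
  obtain ⟨ρs, θ₀, hρs, hθ₀, L₁, h⟩ := hFS
  refine ⟨ρs, hρs, ?_, max L₁ 3, fun L _ hL hev ψ hgs h1 => ?_⟩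
  · -- Bloch ceiling at the even side `2(L₁ + 2) ≥ L₁`
    haveI : NeZero (2 * (L₁ + 2)) := ⟨by omega⟩
    have h' := h (2 * (L₁ + 2)) (by omega) (even_two_mul _) θ₀ (by rw [abs_of_pos hθ₀])
    exact stiffness_le_two U δ hθ₀.ne' h'
  · have hL₁ : L₁ ≤ L := le_trans (le_max_left _ _) hL
    have hL3 : 3 ≤ L := le_trans (le_max_right _ _) hL
    have h' : ∀ θ : ℝ, |θ| ≤ θ₀ → ρs * θ ^ 2 ≤ fluxEnergy L U δ θ - fluxEnergy L U δ 0 :=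
      h L hL₁ hev
    refine ⟨sum_im_hop_eq_zero_of_isGroundStateInSector hL3 U δ hθ₀ (fun θ hθ => ?_) hgs h1,
      stiffness_mul_sq_le_sum_re_hop_of_isGroundStateInSector hL3 U δ hρs hθ₀ h' hgs h1⟩
    have := h' θ hθ
    nlinarith [sq_nonneg θ]

end Literature.MathematicalPhysics.QuantumLattice

end
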